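import Mathlib
import Summits.ResolutionOfSingularities.ResolutionOfSingularities.Theorems.HomologicalConductorPersistenceCyclicTransferAbelianCoinduced
import Summits.ResolutionOfSingularities.ResolutionOfSingularities.Theorems.HomologicalConductorPersistenceCyclicTransferPairing
import HarnessLib

/-!
# Crux `Persistence` (stmt-16484) / rung S-2 `PersistenceSurface` (stmt-19970) — finite-group transfer, the PERFECT
# REYNOLDS PAIRING from normality + (BIG), and T-V with standard hypotheses for every finite group
# (chain W4.4b, seat res-L1-w44b-stub-4 gen 5; T-V package part 11)

[OURS · L1 w44b · rung S-2] Nothing here is a statement of the manuscript under review (Hironaka 2017);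
AI-written, weaker than expert review.  Part 6 (`…CyclicTransferPairing`: isotypic projectors, «a `U`-linear form
is a multiplication on each isotypic component», perfect Reynolds pairing, Frobenius hypothesis from normality) with
the cyclic `σ` replaced by a finite group `G` acting through `σ : G →* (V →ₐ[U] V)` (fixed ring `U`) and
characters `χ x : G → U` (`x : Λ`), so that part 10's `mul_mem_cohomologyAnnihilatorOfDegree_three_group` gets its
Frobenius hypothesis DISCHARGED: the ONE-STEP transfer for the non-cyclic UAC discriminant groups
(Z11, Z13, W13 of S-2) holds under the same standard hypotheses as the cyclic one.

SETTING / HYPOTHESES. `V` a noetherian NORMAL DOMAIN, `U` noetherian; `σ : G →* (V →ₐ[U] V)` with fixed ring `U`;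
`χ : Λ → G → U`, `χ x 1 = 1`, `χ x (g h) = χ x g · χ x h`, SECOND ORTHOGONALITY `∑_x χ x g = 0` (`g ≠ 1`),
`|Λ|, |G| ∈ Uˣ`; **(BIG)**: for every `x : Λ` and every height-one prime `P ⊂ V` some element of character `χ x`
avoids `P` (for a diagonal action on a graded 2-dimensional normal domain with `V₀ = k`: the action is free off the
vertex).

RESULTS.
* `character_pow`, `pow_card_character_eq_one`, `character_inv_mul`, `pow_card_pred_character_eq` — bookkeeping
  (`(χ x g)^{|G|} = 1`, `(χ x g)^{|G|-1} = χ x g⁻¹`).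
* `apply_projector_eq_group`, `sum_projector_eq_group` — the isotypic projectors `P_x v = ∑_g χ x g⁻¹ · σ g v`
  have character `χ x`, and `∑_x P_x v = |Λ| v`.
* `exists_eq_mul_of_character_group` — a `U`-linear `φ : V → U` is multiplication by some `y` of character
  `g ↦ χ x g⁻¹` on `V_[χ x]` (invariants `m₀^{|G|-1} m`, `m₀^{|G|}`; Krull `⋂_{ht P = 1} V_P = V`,
  `Literature.RingTheory.IntegralClosure.exists_algebraMap_eq_of_forall_height_eq_one`).
* `reynoldsPairing_existsUnique_group` — PERFECT PAIRING: every `φ` is `v ↦ ρ(v w)` for a unique `w`.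
* `finite_projective_coind_of_isIntegrallyClosed_group` — the Frobenius hypothesis.
* **`mul_mem_cohomologyAnnihilatorOfDegree_three_of_isIntegrallyClosed_group`** — T-V with standard hypotheses
  for a finite group: `c ∈ ca³(V)` of character `ψ`, `a ∈ 𝔞_ψ^G` ⟹ `a c ∈ ca³(U)`; `…_bicharacter` form
  (`Λ = G`, `χ` a bicharacter, `ψ = χ x_c`, partner `(x x_c)⁻¹`).

References: Iyengar–Takahashi, IMRN 2016, arXiv:1404.1476, Remark 2.13 [`IyengarTakahashi2014`]; Matsumura,
Commutative Ring Theory, Thm 11.5 (normal ⟹ `⋂_{ht 1} R_P = R`); character theory of finite groups (folklore).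
-/

-- single-problem summit: the doubled namespace component `ResolutionOfSingularities` is forced
set_option linter.dupNamespace false

noncomputable section

open CategoryTheory Literature.RingTheory.CohomologyAnnihilator
open Summit.ResolutionOfSingularities.ResolutionOfSingularities.Theorems.NoZeno.SandwichCluster
open Summit.ResolutionOfSingularities.ResolutionOfSingularities.Theorems.HomologicalConductor.PersistenceCyclicTransferFamily
open Summit.ResolutionOfSingularities.ResolutionOfSingularities.Theorems.HomologicalConductor.PersistenceCyclicTransferSyzygy
open Summit.ResolutionOfSingularities.ResolutionOfSingularities.Theorems.HomologicalConductor.PersistenceCyclicTransferAbelian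
open Summit.ResolutionOfSingularities.ResolutionOfSingularities.Theorems.HomologicalConductor.PersistenceCyclicTransferAbelianCoinduced

universe u

namespace Summit.ResolutionOfSingularities.ResolutionOfSingularities.Theorems.HomologicalConductor.PersistenceCyclicTransferAbelianPairing

variable {U V : Type u} [CommRing U] [CommRing V] [Algebra U V]
variable {G : Type*} [Group G] [Fintype G]

/-! ## Character bookkeeping -/

omit [Fintype G] in
/-- `(χ x g)^n = χ x (g^n)` for a multiplicative character with `χ x 1 = 1`. [folklore] -/
theorem character_pow {Λ : Type*} (χ : Λ → G → U) (hχone : ∀ x, χ x 1 = 1)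
    (hχmul : ∀ x g h, χ x (g * h) = χ x g * χ x h) (x : Λ) (g : G) (n : ℕ) : χ x g ^ n = χ x (g ^ n) := by
  induction n with
  | zero => rw [pow_zero, pow_zero, hχone]
  | succ n ih => rw [pow_succ, ih, pow_succ, hχmul]

/-- `(χ x g)^{|G|} = 1`. [folklore] -/
theorem pow_card_character_eq_one {Λ : Type*} (χ : Λ → G → U) (hχone : ∀ x, χ x 1 = 1)
    (hχmul : ∀ x g h, χ x (g * h) = χ x g * χ x h) (x : Λ) (g : G) : χ x g ^ Fintype.card G = 1 := by
  rw [character_pow χ hχone hχmul, pow_card_eq_one, hχone]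

omit [Fintype G] in
/-- `χ x g⁻¹ · χ x g = 1`. [folklore] -/
theorem character_inv_mul {Λ : Type*} (χ : Λ → G → U) (hχone : ∀ x, χ x 1 = 1)
    (hχmul : ∀ x g h, χ x (g * h) = χ x g * χ x h) (x : Λ) (g : G) : χ x g⁻¹ * χ x g = 1 := by
  rw [← hχmul, inv_mul_cancel, hχone]

/-- `(χ x g)^{|G| - 1} = χ x g⁻¹`. [folklore] -/
theorem pow_card_pred_character_eq {Λ : Type*} (χ : Λ → G → U) (hχone : ∀ x, χ x 1 = 1)
    (hχmul : ∀ x g h, χ x (g * h) = χ x g * χ x h) (x : Λ) (g : G) :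
    χ x g ^ (Fintype.card G - 1) = χ x g⁻¹ := by
  have hpos : 0 < Fintype.card G := Fintype.card_pos
  have h1 : χ x g ^ (Fintype.card G - 1) * χ x g = 1 := by
    rw [← pow_succ, Nat.sub_add_cancel hpos, pow_card_character_eq_one χ hχone hχmul]
  calc χ x g ^ (Fintype.card G - 1) = χ x g ^ (Fintype.card G - 1) * (χ x g⁻¹ * χ x g) := by
        rw [character_inv_mul χ hχone hχmul, mul_one]
    _ = χ x g⁻¹ * (χ x g ^ (Fintype.card G - 1) * χ x g) := by ring
    _ = χ x g⁻¹ := by rw [h1, mul_one]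

/-! ## Isotypic projectors for a finite group -/

/-- The ISOTYPIC PROJECTOR `P_x v = ∑_g χ x g⁻¹ · σ g v` has character `χ x`: `σ h (P_x v) = χ x h · P_x v`.
[folklore] -/
theorem apply_projector_eq_group (σ : G →* (V →ₐ[U] V)) {Λ : Type*} (χ : Λ → G → U)
    (hχmul : ∀ x g h, χ x (g * h) = χ x g * χ x h) (x : Λ) (h : G) (v : V) :
    σ h (∑ g, algebraMap U V (χ x g⁻¹) * σ g v) =
      algebraMap U V (χ x h) * ∑ g, algebraMap U V (χ x g⁻¹) * σ g v := by
  classical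
  have hσσ : ∀ g, σ h (σ (h⁻¹ * g) v) = σ g v := fun g => by
    rw [← AlgHom.mul_apply, ← map_mul, mul_inv_cancel_left]
  rw [map_sum, Finset.mul_sum,
    ← Equiv.sum_comp (Equiv.mulLeft h⁻¹) (fun g => σ h (algebraMap U V (χ x g⁻¹) * σ g v))]
  refine Finset.sum_congr rfl fun g _ => ?_
  simp only [Equiv.coe_mulLeft]
  rw [map_mul, AlgHom.commutes, hσσ, mul_inv_rev, inv_inv, hχmul, map_mul]
  ring

/-- The isotypic projectors sum to `|Λ|`: `∑_x P_x v = |Λ| v` (second orthogonality). [folklore] -/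
theorem sum_projector_eq_group (σ : G →* (V →ₐ[U] V)) {Λ : Type*} [Fintype Λ] (χ : Λ → G → U)
    (hχone : ∀ x, χ x 1 = 1) (horth : ∀ g : G, g ≠ 1 → ∑ x, χ x g = 0) (v : V) :
    ∑ x, ∑ g, algebraMap U V (χ x g⁻¹) * σ g v = ((Fintype.card Λ : ℕ) : V) * v := by
  classical
  rw [Finset.sum_comm]
  have hcoef : ∀ g : G, ∑ x, algebraMap U V (χ x g⁻¹) = if g = 1 then ((Fintype.card Λ : ℕ) : V) else 0 := by
    intro g
    rw [← map_sum]
    by_cases hg : g = 1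
    · subst hg
      simp only [inv_one, hχone, Finset.sum_const, Finset.card_univ, nsmul_eq_mul, mul_one, map_natCast, if_true]
    · rw [if_neg hg, horth g⁻¹ (inv_ne_one.mpr hg), map_zero]
  rw [Finset.sum_congr rfl fun g _ => by rw [← Finset.sum_mul, hcoef g],
    Fintype.sum_eq_single 1 (fun g hg => by rw [if_neg hg, zero_mul]), if_pos rfl, map_one, AlgHom.one_apply]

/-! ## Linear forms on an isotypic component are multiplications (normal domain, Krull) -/

section Normal

variable [IsDomain V] [IsNoetherianRing V] [IsIntegrallyClosed V]

/-- **A `U`-linear form is a multiplication on each isotypic component (finite group).**  `V` a noetherian normal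
domain; if some element of character `χ x` avoids each height-one prime, then for every `U`-linear `φ : V → U`
there is `y ∈ V` with `σ g y = χ x g⁻¹ · y` and `φ(m) = m·y` for all `m` of character `χ x`.  Proof as in part 6:
`m₀ φ(m) = m φ(m₀)` via the invariants `m₀^{|G|-1} m`, `m₀^{|G|}`; the fraction `φ(m₀)/m₀` lies in every `V_P`,
`ht P = 1`, hence in `V`. [folklore] -/
theorem exists_eq_mul_of_character_group (σ : G →* (V →ₐ[U] V))
    (hfix : ∀ v : V, (∀ g, σ g v = v) → ∃ u : U, algebraMap U V u = v) {Λ : Type*} (χ : Λ → G → U)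
    (hχone : ∀ x, χ x 1 = 1) (hχmul : ∀ x g h, χ x (g * h) = χ x g * χ x h) (x : Λ)
    (hbig : ∀ P : Ideal V, P.IsPrime → P.height = 1 →
      ∃ m : V, (∀ g, σ g m = algebraMap U V (χ x g) * m) ∧ m ∉ P)
    (φ : ((ModuleCat.restrictScalars (algebraMap U V)).obj (ModuleCat.of V V)) →ₗ[U] U) :
    ∃ y : V, (∀ g, σ g y = algebraMap U V (χ x g⁻¹) * y) ∧
      ∀ m : V, (∀ g, σ g m = algebraMap U V (χ x g) * m) → algebraMap U V (φ m) = m * y := by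
  classical
  set n := Fintype.card G with hn'
  have hn : 0 < n := Fintype.card_pos
  set η : G → V := fun g => algebraMap U V (χ x g) with hηdef
  have hηn : ∀ g, η g ^ n = 1 := fun g => by
    rw [hηdef]
    simp only
    rw [← map_pow, pow_card_character_eq_one χ hχone hχmul, map_one]
  have hηpred : ∀ g, η g ^ (n - 1) * η g = 1 := fun g => by rw [← pow_succ, Nat.sub_add_cancel hn, hηn]
  have hηinv : ∀ g, algebraMap U V (χ x g⁻¹) * η g = 1 := fun g => by
    rw [hηdef]
    simp only
    rw [← map_mul, character_inv_mul χ hχone hχmul, map_one]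
  let toW : V → ((ModuleCat.restrictScalars (algebraMap U V)).obj (ModuleCat.of V V)) := fun v => v
  have hφW : ∀ m : V, φ m = φ (toW m) := fun _ => rfl
  rcases em (∃ m₀ : V, (∀ g, σ g m₀ = η g * m₀) ∧ m₀ ≠ 0) with ⟨m₀, hm₀, hm₀ne⟩ | hzero
  swap
  · have hz : ∀ m : V, (∀ g, σ g m = η g * m) → m = 0 := fun m hm => by
      by_contra hne
      exact hzero ⟨m, hm, hne⟩
    refine ⟨0, fun g => by simp, fun m hm => ?_⟩
    rw [hz m hm, hφW, show toW 0 = 0 from rfl, map_zero, map_zero, zero_mul]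
  -- `m₀ φ(m) = m φ(m₀)` on the component
  have key : ∀ m : V, (∀ g, σ g m = η g * m) →
      m₀ * algebraMap U V (φ (toW m)) = m * algebraMap U V (φ (toW m₀)) := by
    intro m hm
    have hu₁ : ∀ g, σ g (m₀ ^ (n - 1) * m) = m₀ ^ (n - 1) * m := fun g => by
      rw [map_mul, map_pow, hm₀ g, hm g, mul_pow]
      linear_combination (m₀ ^ (n - 1) * m) * hηpred g
    obtain ⟨u₁, hu₁'⟩ := hfix _ hu₁
    have hu₀ : ∀ g, σ g (m₀ ^ n) = m₀ ^ n := fun g => by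
      rw [map_pow, hm₀ g, mul_pow, hηn, one_mul]
    obtain ⟨u₀, hu₀'⟩ := hfix _ hu₀
    have hsm : u₀ • toW m = u₁ • toW m₀ := by
      change toW (algebraMap U V u₀ * m) = toW (algebraMap U V u₁ * m₀)
      rw [hu₀', hu₁', mul_right_comm, ← pow_succ, Nat.sub_add_cancel hn]
    have h1 : u₀ * φ (toW m) = u₁ * φ (toW m₀) := by
      rw [← smul_eq_mul, ← smul_eq_mul, ← map_smul, ← map_smul, hsm]
    have h2 := congrArg (algebraMap U V) h1
    rw [map_mul, map_mul, hu₀', hu₁'] at h2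
    have h3 : m₀ ^ (n - 1) * (m₀ * algebraMap U V (φ (toW m)) - m * algebraMap U V (φ (toW m₀))) = 0 := by
      rw [mul_sub, ← mul_assoc, ← pow_succ, Nat.sub_add_cancel hn, h2]
      ring
    exact sub_eq_zero.mp ((mul_eq_zero.mp h3).resolve_left (pow_ne_zero _ hm₀ne))
  -- the fraction `φ(m₀)/m₀` lies in `V`
  let K := FractionRing V
  have hm₀K : algebraMap V K m₀ ≠ 0 := IsFractionRing.to_map_eq_zero_iff.not.mpr hm₀ne
  let f : K := algebraMap V K (algebraMap U V (φ (toW m₀))) / algebraMap V K m₀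
  have hfm : ∀ m : V, (∀ g, σ g m = η g * m) →
      algebraMap V K m * f = algebraMap V K (algebraMap U V (φ (toW m))) := by
    intro m hm
    change algebraMap V K m * (algebraMap V K (algebraMap U V (φ (toW m₀))) / algebraMap V K m₀) = _
    rw [div_eq_mul_inv, ← mul_assoc, ← map_mul, ← key m hm, map_mul, mul_right_comm, mul_inv_cancel₀ hm₀K,
      one_mul]
  obtain ⟨y, hy⟩ := Literature.RingTheory.IntegralClosure.exists_algebraMap_eq_of_forall_height_eq_one
    (R := V) (K := K) f fun P hP hP1 => by
      obtain ⟨m, hm, hmP⟩ := hbig P hP hP1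
      exact ⟨m, hmP, algebraMap U V (φ (toW m)), hfm m hm⟩
  have hmul : ∀ m : V, (∀ g, σ g m = η g * m) → algebraMap U V (φ (toW m)) = m * y := by
    intro m hm
    apply IsFractionRing.injective V K
    rw [map_mul, hy, hfm m hm]
  refine ⟨y, fun g => ?_, fun m hm => by rw [hφW]; exact hmul m hm⟩
  -- character of `y`: apply `σ g` to `m₀ y = φ(m₀)`
  have h0 := hmul m₀ hm₀
  have h1 : σ g (m₀ * y) = m₀ * y := by rw [← h0, AlgHom.commutes]
  rw [map_mul, hm₀ g] at h1
  have h2 : m₀ * (η g * σ g y - y) = 0 := by linear_combination h1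
  have h3 : η g * σ g y = y := sub_eq_zero.mp ((mul_eq_zero.mp h2).resolve_left hm₀ne)
  calc σ g y = algebraMap U V (χ x g⁻¹) * η g * σ g y := by rw [hηinv g, one_mul]
    _ = algebraMap U V (χ x g⁻¹) * y := by rw [mul_assoc, h3]

/-- **PERFECT REYNOLDS PAIRING (finite group).**  `V` a noetherian normal domain with (BIG) for every character
`χ x`, `|Λ| ∈ Uˣ`; `ρ : V → U` any `U`-linear map with `|G|·ρ = ∑_g σ g` (the Reynolds operator).  Then every `U`-linear `φ : V → U` is
`v ↦ ρ(v w)` for a UNIQUE `w ∈ V` (`w = |Λ|⁻¹|G| ∑_x y_x` with `y_x` from `exists_eq_mul_of_character_group`;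
uniqueness: `|G| ρ(q^{|G|-1} δ) = q^{|G|}` for the isotypic component `q = P_x δ`). [folklore] -/
theorem reynoldsPairing_existsUnique_group (σ : G →* (V →ₐ[U] V))
    (hfix : ∀ v : V, (∀ g, σ g v = v) → ∃ u : U, algebraMap U V u = v)
    (hinj : Function.Injective (algebraMap U V)) {Λ : Type*} [Fintype Λ] (χ : Λ → G → U)
    (hχone : ∀ x, χ x 1 = 1) (hχmul : ∀ x g h, χ x (g * h) = χ x g * χ x h)
    (horth : ∀ g : G, g ≠ 1 → ∑ x, χ x g = 0) (hΛU : IsUnit ((Fintype.card Λ : ℕ) : U))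
    (hbig : ∀ (x : Λ) (P : Ideal V), P.IsPrime → P.height = 1 →
      ∃ m : V, (∀ g, σ g m = algebraMap U V (χ x g) * m) ∧ m ∉ P)
    (ρ : V →ₗ[U] U)
    (hρsum : ∀ v, ((Fintype.card G : ℕ) : V) * algebraMap U V (ρ v) = ∑ g, σ g v)
    (φ : ((ModuleCat.restrictScalars (algebraMap U V)).obj (ModuleCat.of V V)) →ₗ[U] U) :
    ∃! w : V, ∀ v : V, φ v = ρ (v * w) := by
  classical
  set n := Fintype.card G with hn'
  have hn : 0 < n := Fintype.card_pos
  let toW : V → ((ModuleCat.restrictScalars (algebraMap U V)).obj (ModuleCat.of V V)) := fun v => v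
  have hφW : ∀ m : V, φ m = φ (toW m) := fun _ => rfl
  obtain ⟨uΛ, huΛ⟩ := hΛU
  have hΛV : IsUnit ((Fintype.card Λ : ℕ) : V) := by
    rw [← map_natCast (algebraMap U V), ← huΛ]; exact (uΛ.isUnit).map _
  -- the projectors
  let Pr : Λ → V → V := fun x v => ∑ g, algebraMap U V (χ x g⁻¹) * σ g v
  have hPr : ∀ x h v, σ h (Pr x v) = algebraMap U V (χ x h) * Pr x v := fun x h v =>
    apply_projector_eq_group σ χ hχmul x h v
  have hPrsum : ∀ v, ∑ x, Pr x v = ((Fintype.card Λ : ℕ) : V) * v := fun v =>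
    sum_projector_eq_group σ χ hχone horth v
  -- the isotypic multipliers `y_x`
  choose y hychar hy using fun x : Λ => exists_eq_mul_of_character_group σ hfix χ hχone hχmul x (hbig x) φ
  -- `∑_g σ g (v w') = ∑_x P_x(v) y_x` for `w' = ∑ y_x`
  have hsumσ : ∀ v, ∑ g, σ g (v * ∑ x, y x) = ∑ x, Pr x v * y x := by
    intro v
    have : ∀ g, σ g (v * ∑ x, y x) = ∑ x, algebraMap U V (χ x g⁻¹) * σ g v * y x := fun g => by
      rw [map_mul, map_sum, Finset.mul_sum]
      refine Finset.sum_congr rfl fun x _ => ?_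
      rw [hychar x g]
      ring
    simp only [this]
    rw [Finset.sum_comm]
    exact Finset.sum_congr rfl fun x _ => (Finset.sum_mul _ _ _).symm
  -- both sides of the pairing identity, mapped to `V`
  have hR : ∀ v, algebraMap U V ((n : U) * ρ (v * ∑ x, y x)) = ∑ x, Pr x v * y x := fun v => by
    rw [map_mul, map_natCast, hn', hρsum, hsumσ]
  have hL : ∀ v : V, algebraMap U V (((Fintype.card Λ : ℕ) : U) * φ v) = ∑ x, Pr x v * y x := by
    intro v
    have e1 : ((Fintype.card Λ : ℕ) : U) * φ v = φ (((Fintype.card Λ : ℕ) : U) • toW v) := by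
      rw [map_smul, smul_eq_mul]
    have e2 : ((Fintype.card Λ : ℕ) : U) • toW v = toW (∑ x, Pr x v) := by
      change toW (algebraMap U V ((Fintype.card Λ : ℕ) : U) * v) = toW (∑ x, Pr x v)
      rw [map_natCast, hPrsum]
    rw [e1, e2, show toW (∑ x, Pr x v) = ∑ x, toW (Pr x v) from rfl, map_sum, map_sum]
    exact Finset.sum_congr rfl fun x _ => hy x (Pr x v) (hPr x · v)
  -- the element `w = |Λ|⁻¹ |G| ∑ y_x`
  let w : V := algebraMap U V (↑uΛ⁻¹ * (n : U)) * ∑ x, y x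
  have hρw : ∀ v, ρ (v * w) = (↑uΛ⁻¹ * (n : U)) * ρ (v * ∑ x, y x) := fun v => by
    change ρ (v * (algebraMap U V (↑uΛ⁻¹ * (n : U)) * ∑ x, y x)) = _
    rw [mul_left_comm, ← Algebra.smul_def, map_smul, smul_eq_mul]
  have hpair : ∀ v : V, φ v = ρ (v * w) := fun v => by
    have e : ((Fintype.card Λ : ℕ) : U) * φ v = (n : U) * ρ (v * ∑ x, y x) :=
      hinj ((hL v).trans (hR v).symm)
    rw [hρw, mul_assoc, ← e, ← mul_assoc, ← huΛ, Units.inv_mul, one_mul]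
  refine ⟨w, hpair, fun w' hw' => ?_⟩
  -- uniqueness: `δ := w' - w` pairs to zero with everything, hence every isotypic component vanishes
  set δ := w' - w with hδ
  have hzero : ∀ v : V, ρ (v * δ) = 0 := fun v => by
    rw [hδ, mul_sub, map_sub, ← hw' v, ← hpair v, sub_self]
  have hcomp : ∀ x, Pr x δ = 0 := by
    intro x
    set q := Pr x δ with hq
    have hqσ : ∀ g, σ g q = algebraMap U V (χ x g) * q := fun g => hPr x g δ
    have hpow : ∀ g, algebraMap U V (χ x g) ^ (n - 1) = algebraMap U V (χ x g⁻¹) := fun g => by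
      rw [← map_pow, hn', pow_card_pred_character_eq χ hχone hχmul]
    have h1 : (n : V) * algebraMap U V (ρ (q ^ (n - 1) * δ)) = q ^ (n - 1) * q := by
      rw [hn', hρsum]
      change _ = q ^ (Fintype.card G - 1) * ∑ g, algebraMap U V (χ x g⁻¹) * σ g δ
      rw [Finset.mul_sum]
      refine Finset.sum_congr rfl fun g _ => ?_
      rw [map_mul, map_pow, hqσ g, mul_pow, ← hn', hpow g]
      ring
    rw [hzero, map_zero, mul_zero, ← pow_succ, Nat.sub_add_cancel hn] at h1
    exact (pow_eq_zero_iff (Nat.pos_iff_ne_zero.mp hn)).mp h1.symm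
  have hΛδ : ((Fintype.card Λ : ℕ) : V) * δ = 0 := by
    rw [← hPrsum δ]
    exact Finset.sum_eq_zero fun x _ => hcomp x
  have : δ = 0 := (hΛV.mul_right_eq_zero).mp hΛδ
  rw [hδ, sub_eq_zero] at this
  exact this

/-- **The Frobenius hypothesis from normality (finite group)**: `V` a noetherian normal domain with (BIG), fixed ring
`U`, characters with orthogonality, `|Λ|, |G| ∈ Uˣ` ⟹ `Hom_U(V, U)` is a finitely generated projective
`V`-module. [folklore] -/
theorem finite_projective_coind_of_isIntegrallyClosed_group (σ : G →* (V →ₐ[U] V))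
    (hfix : ∀ v : V, (∀ g, σ g v = v) → ∃ u : U, algebraMap U V u = v)
    (hinj : Function.Injective (algebraMap U V)) {Λ : Type*} [Fintype Λ] (χ : Λ → G → U)
    (hχone : ∀ x, χ x 1 = 1) (hχmul : ∀ x g h, χ x (g * h) = χ x g * χ x h)
    (horth : ∀ g : G, g ≠ 1 → ∑ x, χ x g = 0) (hΛU : IsUnit ((Fintype.card Λ : ℕ) : U))
    (hGU : IsUnit ((Fintype.card G : ℕ) : U))
    (hbig : ∀ (x : Λ) (P : Ideal V), P.IsPrime → P.height = 1 →
      ∃ m : V, (∀ g, σ g m = algebraMap U V (χ x g) * m) ∧ m ∉ P) :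
    Module.Finite V (((ModuleCat.restrictScalars (algebraMap U V)).obj (ModuleCat.of V V)) →ₗ[U] U) ∧
      Module.Projective V (((ModuleCat.restrictScalars (algebraMap U V)).obj (ModuleCat.of V V)) →ₗ[U] U) := by
  obtain ⟨ρ, -, -, hρsum⟩ := exists_reynolds_group σ hfix hinj hGU
  exact finite_projective_of_reynoldsPairing ρ
    (reynoldsPairing_existsUnique_group σ hfix hinj χ hχone hχmul horth hΛU hbig ρ hρsum)

/-! ## T-V with standard hypotheses, finite group -/

/-- **ONE-STEP TRANSFER (finite group) at level `ca³`, standard hypotheses.**  `U` noetherian, `V` a noetherian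
normal domain, `σ : G →* (V →ₐ[U] V)` with fixed ring `U`, characters `χ x` (`x : Λ`) multiplicative with second
orthogonality, `|Λ|, |G| ∈ Uˣ`, and (BIG) for every `χ x`.  Then `c ∈ ca³(V)` of character `ψ` and `a ∈ 𝔞_ψ^G`
(decomposition data) give `a c ∈ ca³(U)`. [folklore] -/
theorem mul_mem_cohomologyAnnihilatorOfDegree_three_of_isIntegrallyClosed_group [IsNoetherianRing U]
    (σ : G →* (V →ₐ[U] V)) (hfix : ∀ v : V, (∀ g, σ g v = v) → ∃ u : U, algebraMap U V u = v)
    (hinj : Function.Injective (algebraMap U V)) {Λ : Type*} [Fintype Λ] (χ : Λ → G → U)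
    (hχone : ∀ x, χ x 1 = 1) (hχmul : ∀ x g h, χ x (g * h) = χ x g * χ x h)
    (horth : ∀ g : G, g ≠ 1 → ∑ x, χ x g = 0) (hΛU : IsUnit ((Fintype.card Λ : ℕ) : U))
    (hGU : IsUnit ((Fintype.card G : ℕ) : U))
    (hbig : ∀ (x : Λ) (P : Ideal V), P.IsPrime → P.height = 1 →
      ∃ m : V, (∀ g, σ g m = algebraMap U V (χ x g) * m) ∧ m ∉ P)
    {c : V} (hc3 : c ∈ cohomologyAnnihilatorOfDegree V 3) (ψ : G → U)
    (hc : ∀ g, σ g c = algebraMap U V (ψ g) * c) {a : V}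
    (ha : ∀ x : Λ, ∃ (m : ℕ) (b b' : Fin m → V) (y : Λ), (∀ k g, σ g (b k) = algebraMap U V (χ x g) * b k) ∧
      (∀ k g, σ g (b' k) = algebraMap U V (χ y g) * b' k) ∧ (∀ g, χ y g * χ x g * ψ g = 1) ∧
      ∑ k, b k * b' k = a)
    (u : U) (hu : algebraMap U V u = a * c) : u ∈ cohomologyAnnihilatorOfDegree U 3 := by
  obtain ⟨hfin, hproj⟩ :=
    finite_projective_coind_of_isIntegrallyClosed_group σ hfix hinj χ hχone hχmul horth hΛU hGU hbig
  exact mul_mem_cohomologyAnnihilatorOfDegree_three_group σ hfix hinj χ hχone hχmul horth hΛU hGU hc3 ψ hc ha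
    u hu

/-- **ONE-STEP TRANSFER, bicharacter form, standard hypotheses** (`G` finite abelian with dual `Ĝ ≅ G` realised by
a bicharacter `χ`; `V` noetherian normal domain with (BIG) for every `χ x`; `U = V^G` noetherian): `c ∈ ca³(V)` of
character `χ x_c` and `a ∈ 𝔞_{x_c}^G = ⋂_x V_[x] V_[(x x_c)⁻¹]` ⟹ `a c ∈ ca³(U)` — the floor
`∑_{x_c} 𝔞_{x_c}^H (ca³(V) V)_[x_c] ⊆ ca³(V^H)` for the UAC covers with non-cyclic `H = D(Γ)`. [folklore] -/
theorem mul_mem_cohomologyAnnihilatorOfDegree_three_of_isIntegrallyClosed_bicharacter [IsNoetherianRing U]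
    (σ : G →* (V →ₐ[U] V)) (hfix : ∀ v : V, (∀ g, σ g v = v) → ∃ u : U, algebraMap U V u = v)
    (hinj : Function.Injective (algebraMap U V)) (χ : G → G → U) (hχone₁ : ∀ g, χ 1 g = 1)
    (hχmul₁ : ∀ x x' g, χ (x * x') g = χ x g * χ x' g) (hχone₂ : ∀ x, χ x 1 = 1)
    (hχmul₂ : ∀ x g h, χ x (g * h) = χ x g * χ x h) (horth : ∀ g : G, g ≠ 1 → ∑ x, χ x g = 0)
    (hGU : IsUnit ((Fintype.card G : ℕ) : U))
    (hbig : ∀ (x : G) (P : Ideal V), P.IsPrime → P.height = 1 →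
      ∃ m : V, (∀ g, σ g m = algebraMap U V (χ x g) * m) ∧ m ∉ P)
    {c : V} (hc3 : c ∈ cohomologyAnnihilatorOfDegree V 3) (xc : G)
    (hc : ∀ g, σ g c = algebraMap U V (χ xc g) * c) {a : V}
    (ha : ∀ x : G, ∃ (m : ℕ) (b b' : Fin m → V), (∀ k g, σ g (b k) = algebraMap U V (χ x g) * b k) ∧
      (∀ k g, σ g (b' k) = algebraMap U V (χ (x * xc)⁻¹ g) * b' k) ∧ ∑ k, b k * b' k = a)
    (u : U) (hu : algebraMap U V u = a * c) : u ∈ cohomologyAnnihilatorOfDegree U 3 := by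
  refine mul_mem_cohomologyAnnihilatorOfDegree_three_of_isIntegrallyClosed_group σ hfix hinj χ hχone₂ hχmul₂
    horth hGU hGU hbig hc3 (χ xc) hc (fun x => ?_) u hu
  obtain ⟨m, b, b', hb, hb', hab⟩ := ha x
  refine ⟨m, b, b', (x * xc)⁻¹, hb, hb', fun g => ?_, hab⟩
  rw [mul_assoc, ← hχmul₁ x xc g, ← hχmul₁, inv_mul_cancel, hχone₁]

end Normal

end Summit.ResolutionOfSingularities.ResolutionOfSingularities.Theorems.HomologicalConductor.PersistenceCyclicTransferAbelianPairing

end
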